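import Literature.Barriers.CriticalPhenomena.GaussianDominationRouteNoble
import Mathlib.Analysis.Normed.Ring.InfiniteSum
import HarnessLib

/-!
# [FitHof13b] Lemma 3.5 for percolation, PROVED: continuity of the weighted diagrams
# `p ↦ sup_{x ∈ S} ℋ^{n,l}_p(x)` below `p_c`; `FitznerVanDerHofstad2017_nobleBound` reduced to the
# computer-assisted Prop. 2.4 alone

Sibling proof file of `GaussianDominationRouteNoble.lean` (barrier catalogue
`Literature/Barriers/CriticalPhenomena/`). That file split the NoBLE node
`FitznerVanDerHofstad2017_nobleBound` of the percolation infrared bound (`d ≥ 11`) into the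
computer-assisted bootstrap `FitznerVanDerHofstad2017_prop24` (Fitzner–van der Hofstad 2017,
Prop. 2.4 with its initialisation: claims (ii)–(iii) of §2.4) and the continuity claim (i) for the
three printed bootstrap functions, proving (i) for `f₁` and `f₂` and vendoring (i) for `f₃` as the
named fact `FitznerVanDerHofstad2016NoBLE_lemma35` ([FitHof13b] = Fitzner–van der Hofstad,
PTRF 169 (2017), Lemma 3.5: "`z ↦ f₃(z)` … is continuous in `z ∈ [z_I, z_c)`", via "the continuity
of `z ↦ sup_{x∈S} ℋ^{n,l}_z(x)` for all sets `S`", `ℋ^{n,l}_z(x) = Σ_y ‖y‖₂² G_z(y)(G_z^{⋆n} ⋆ D^{⋆l})(x-y)`).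
Here that fact is DISCHARGED (`FitznerVanDerHofstad2016NoBLE_lemma35_holds`), so that
`FitznerVanDerHofstad2017_nobleBound` — hence HvdH Thm. 10.1,
`FitznerVanDerHofstad2017_infraredBound` — follows from `FitznerVanDerHofstad2017_prop24` alone
(`FitznerVanDerHofstad2017_nobleBound_of_prop24'`, `FitznerVanDerHofstad2017_infraredBound_of_prop24'`).

## The proof (the printed mechanism, with sharpness supplying [FitHof13b] Assumption 2.3)

The printed proof: "`(ℋ^{n,l}_z(x))_{x∈ℤ^d}` is an equicontinuous family of functions and is
uniformly bounded … for all `z ∈ [0, z_c - ε)`. This allows us to obtain the continuity of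
`z ↦ sup_{x∈S} ℋ^{n,l}_z(x)` for all sets `S` directly from the Arzelà–Ascoli Theorem", using
Assumption 2.3 (`Σ_x ‖x‖₂² G_z(x) < K(z)`, `χ(z) < ∞`), which Fitzner–van der Hofstad 2017, §2.4
verify for percolation from the exponential decay `τ_p(x) ≤ e^{-σ(p)‖x‖_∞}` below `p_c` ([Grim99]).
Formally, for nearest-neighbour percolation on `ℤ^d`, `d ≥ 2`:

* `summable_euclidNorm_sq_mul_tau` — `Σ_x ‖x‖₂² τ_p(0,x) < ∞` below `p_c` (Assumption 2.3 for
  percolation; the second-moment bound `summable_normSq_mul_tau_of_lt_criticalProb` of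
  `TwoPointMoments.lean`, from the sharpness theorem `DCT16.perc_sharpness_holds`);
* a small `ℓ¹` convolution calculus on `ℤ^d` for non-negative summable functions
  (`summable_latticeConv`, `tsum_latticeConv` : `Σ (f ⋆ g) = (Σ f)(Σ g)`, `latticeConv_le_tsum_mul`,
  `latticeConv_mono`; powers `hasSum_convPow` : `Σ f^{⋆n} = (Σ f)^n`, `convPow_mono`,
  `convPow_le_one_of_tsum_le_one`; the step distribution `D`: `summable_srwStep`, `tsum_srwStep_le_one`);
* the kernel `K_p = τ_p^{⋆n} ⋆ D^{⋆l}`: `0 ≤ K_p ≤ χ(p)^n`, summable, non-decreasing in `p`, and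
  `ℋ^{n,l}_p = (‖·‖₂² τ_p) ⋆ K_p` (`nobleH_eq_latticeConv`), non-negative and non-decreasing in `p`;
* `tendsto_latticeConv_cofinite` — `(a ⋆ K)(x) → 0` at infinity for `a ∈ ℓ¹`, `K` bounded, `K → 0`;
  hence `ℋ^{n,l}_q(x) → 0` as `x → ∞` for `q < p_c` (`tendsto_nobleH_cofinite`): uniform smallness
  off a finite set, by monotonicity for all `p ≤ q` at once;
* continuity of `p ↦ τ_p^{⋆n}(z)`, `K_p(z)`, `ℋ^{n,l}_p(x)` on `[0, q]`, `q < p_c`, by dominated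
  convergence (`continuousOn_tsum`, dominating families at `q`; the continuity of `p ↦ τ_p(x,y)`
  is `continuous_tau`, Grimmett 1999 §8.3) — the equicontinuity of the printed proof is replaced
  by monotone domination;
* `continuousWithinAt_iSup_of_dominated` — a supremum of non-negative functions continuous in the
  parameter and dominated by a null sequence `B(x) → 0` is continuous (only the finitely many `x`
  with `B(x) ≥ ε/3` matter); with `B = ℋ^{n,l}_q` this gives `continuousOn_nobleSupH` on `[0, p_c)`
  and `FitznerVanDerHofstad2016NoBLE_lemma35_holds`.

## References

* R. Fitzner, R. van der Hofstad, *Generalized approach to the non-backtracking lace expansion*,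
  Probab. Theory Relat. Fields 169 (2017) 1041–1119 (arXiv:1506.07969; [FitHof13b]): (1.1)–(1.3),
  Assumption 2.3, Lemma 2.1, Thm. 2.10, Prop. 2.11, (3.9), Lemma 3.5 and its proof.
* R. Fitzner, R. van der Hofstad, Electron. J. Probab. 22 (2017) no. 43 (arXiv:1506.07977): §2.4
  (claims (i)–(iii); verification of [FitHof13b, Assumption 2.3]), Prop. 2.4.
* H. Duminil-Copin, V. Tassion, Comm. Math. Phys. 343 (2016) 725–745, Thm. 1.1(1) (sharpness).
* G. Grimmett, *Percolation*, 2nd ed. (1999), §6.1 (exponential decay below `p_c`), §8.3.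
-/

noncomputable section

namespace Literature.Barriers.CriticalPhenomena

open MeasureTheory Filter Topology Literature.Probability.LatticeModels Literature.Probability.Percolation
open SpreadOutIsing (delta0 latticeConv convPow delta0_nonneg)
open scoped BigOperators ProbabilityTheory

variable {d : ℕ}

/-! ### Weighted summability of the two-point function below `p_c` -/

/-- **`Σ_x ‖x‖₂² τ_p(0,x) < ∞` for `p < p_c`** (`d ≥ 2`) — the percolation case of [FitHof13b]
Assumption 2.3 ("for each `z ∈ (0,z_c)` there exists `K(z) < ∞` such that
`Σ_x ‖x‖₂² G_z(x) < K(z)`"), verified in Fitzner–van der Hofstad 2017, §2.4 from the exponential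
decay of `τ_p`; here a restatement of `summable_normSq_mul_tau_of_lt_criticalProb`
(`TwoPointMoments.lean`) for the weight `euclidNorm x ^ 2 = Σⱼ xⱼ²`.
[cite: FitznerVanDerHofstad2017, §2.4 ("[FitHof13b Assumption 2.3]")]
[cite: FitznerVanDerHofstad2016NoBLE, Assumption 2.3] -/
theorem summable_euclidNorm_sq_mul_tau (hd : 2 ≤ d) (p : unitInterval)
    (hp : (p : ℝ) < criticalProb (zdGraph d) (0 : Site d)) :
    Summable fun x : Site d => euclidNorm x ^ 2 * tau d p 0 x := by
  refine (summable_normSq_mul_tau_of_lt_criticalProb hd p hp).congr fun x => ?_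
  rw [euclidNorm, Real.sq_sqrt (Finset.sum_nonneg fun j _ => sq_nonneg _)]

/-! ### Convolution on `ℤ^d`: non-negative summable functions -/

section Conv

variable {f g f' g' : Site d → ℝ}

/-- `δ₀ ≤ 1`. [folklore] -/
theorem delta0_le_one (x : Site d) : delta0 x ≤ 1 := by
  unfold delta0; split_ifs <;> norm_num

/-- `δ₀` is summable with sum `1`. [folklore] -/
theorem hasSum_delta0 : HasSum (delta0 : Site d → ℝ) 1 := by
  have : (delta0 : Site d → ℝ) = fun x => if x = 0 then 1 else 0 := rfl
  rw [this]
  exact hasSum_ite_eq 0 1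

/-- The convolution of non-negative functions is non-negative. [folklore] -/
theorem latticeConv_nonneg (hf : ∀ x, 0 ≤ f x) (hg : ∀ x, 0 ≤ g x) (x : Site d) : 0 ≤ latticeConv f g x :=
  tsum_nonneg fun y => mul_nonneg (hf y) (hg _)

/-- **Summability of the convolution family on `ℤ^d × ℤ^d`**: for summable non-negative `f, g`
the family `(x, y) ↦ f(y) g(x - y)` is summable (it is `(y, v) ↦ f(y) g(v)` after the shear
`(x, y) ↦ (y, x - y)`). [folklore] -/
theorem summable_latticeConv_family (hf : Summable f) (hg : Summable g) (hf0 : ∀ x, 0 ≤ f x)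
    (hg0 : ∀ x, 0 ≤ g x) : Summable fun xy : Site d × Site d => f xy.2 * g (xy.1 - xy.2) := by
  have hprod : Summable fun yv : Site d × Site d => f yv.1 * g yv.2 :=
    summable_mul_of_summable_norm (hf.congr fun x => by rw [Real.norm_eq_abs, abs_of_nonneg (hf0 x)])
      (hg.congr fun x => by rw [Real.norm_eq_abs, abs_of_nonneg (hg0 x)])
  -- the shear `e (y, v) = (y + v, y)`
  let e : Site d × Site d ≃ Site d × Site d :=
    { toFun := fun yv => (yv.1 + yv.2, yv.1)
      invFun := fun xy => (xy.2, xy.1 - xy.2)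
      left_inv := fun yv => by simp
      right_inv := fun xy => by simp }
  rw [← e.summable_iff]
  refine hprod.congr fun yv => ?_
  simp [e, Function.comp]

/-- For fixed `x`, the inner family `y ↦ f(y) g(x - y)` is summable. [folklore] -/
theorem summable_latticeConv_inner (hf : Summable f) (hg : Summable g) (hf0 : ∀ x, 0 ≤ f x)
    (hg0 : ∀ x, 0 ≤ g x) (x : Site d) : Summable fun y => f y * g (x - y) :=
  (summable_latticeConv_family hf hg hf0 hg0).prod_factor x

/-- The convolution of summable non-negative functions is summable. [folklore] -/
theorem summable_latticeConv (hf : Summable f) (hg : Summable g) (hf0 : ∀ x, 0 ≤ f x)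
    (hg0 : ∀ x, 0 ≤ g x) : Summable (latticeConv f g) :=
  (summable_latticeConv_family hf hg hf0 hg0).prod

/-- `Σ_x (f ⋆ g)(x) = (Σ f)(Σ g)`. [cite: FitznerVanDerHofstad2016NoBLE, §1.2.1 ("the Fourier transform of f^{⋆n} is f̂^n" at k = 0)] -/
theorem tsum_latticeConv (hf : Summable f) (hg : Summable g) (hf0 : ∀ x, 0 ≤ f x)
    (hg0 : ∀ x, 0 ≤ g x) : ∑' x, latticeConv f g x = (∑' y, f y) * ∑' v, g v := by
  have hfam := summable_latticeConv_family hf hg hf0 hg0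
  have hprod : Summable fun yv : Site d × Site d => f yv.1 * g yv.2 :=
    summable_mul_of_summable_norm (hf.congr fun x => by rw [Real.norm_eq_abs, abs_of_nonneg (hf0 x)])
      (hg.congr fun x => by rw [Real.norm_eq_abs, abs_of_nonneg (hg0 x)])
  let e : Site d × Site d ≃ Site d × Site d :=
    { toFun := fun yv => (yv.1 + yv.2, yv.1)
      invFun := fun xy => (xy.2, xy.1 - xy.2)
      left_inv := fun yv => by simp
      right_inv := fun xy => by simp }
  calc ∑' x, latticeConv f g x = ∑' xy : Site d × Site d, f xy.2 * g (xy.1 - xy.2) :=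
        (hfam.tsum_prod).symm
    _ = ∑' yv : Site d × Site d, f yv.1 * g yv.2 := by
        rw [← e.tsum_eq]; exact tsum_congr fun yv => by simp [e]
    _ = (∑' y, f y) * ∑' v, g v :=
        (tsum_mul_tsum_of_summable_norm
          (hf.congr fun x => by rw [Real.norm_eq_abs, abs_of_nonneg (hf0 x)])
          (hg.congr fun x => by rw [Real.norm_eq_abs, abs_of_nonneg (hg0 x)])).symm

/-- A uniform bound: `(f ⋆ g)(x) ≤ (Σ f) · M` if `0 ≤ g ≤ M`, `f ≥ 0` summable. [folklore] -/
theorem latticeConv_le_tsum_mul (hf : Summable f) (hf0 : ∀ x, 0 ≤ f x) (hg0 : ∀ x, 0 ≤ g x) {M : ℝ}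
    (hgM : ∀ x, g x ≤ M) (x : Site d) : latticeConv f g x ≤ (∑' y, f y) * M := by
  rw [← tsum_mul_right]
  have hs : Summable fun y => f y * g (x - y) :=
    Summable.of_nonneg_of_le (fun y => mul_nonneg (hf0 y) (hg0 _))
      (fun y => mul_le_mul_of_nonneg_left (hgM _) (hf0 y)) (hf.mul_right M)
  exact hs.tsum_le_tsum (fun y => mul_le_mul_of_nonneg_left (hgM _) (hf0 y)) (hf.mul_right M)

/-- Monotonicity of the convolution in both (non-negative) arguments, the larger pair being
summable. [folklore] -/
theorem latticeConv_mono (hf' : Summable f') (hg' : Summable g') (hf0 : ∀ x, 0 ≤ f x)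
    (hg0 : ∀ x, 0 ≤ g x) (hff : ∀ x, f x ≤ f' x) (hgg : ∀ x, g x ≤ g' x) (x : Site d) :
    latticeConv f g x ≤ latticeConv f' g' x := by
  have hf0' : ∀ x, 0 ≤ f' x := fun x => (hf0 x).trans (hff x)
  have hg0' : ∀ x, 0 ≤ g' x := fun x => (hg0 x).trans (hgg x)
  have hs' := summable_latticeConv_inner hf' hg' hf0' hg0' x
  have hle : ∀ y, f y * g (x - y) ≤ f' y * g' (x - y) := fun y =>
    mul_le_mul (hff y) (hgg _) (hg0 _) (hf0' y)
  exact (Summable.of_nonneg_of_le (fun y => mul_nonneg (hf0 y) (hg0 _)) hle hs').tsum_le_tsum hle hs'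

end Conv

/-! ### Convolution powers -/

section ConvPow

variable {f f' : Site d → ℝ}

/-- `f^{⋆n} ≥ 0` for `f ≥ 0`. [folklore] -/
theorem convPow_nonneg_of_nonneg (hf0 : ∀ x, 0 ≤ f x) : ∀ (n : ℕ) (x : Site d), 0 ≤ convPow f n x
  | 0, x => delta0_nonneg x
  | n + 1, x => latticeConv_nonneg (convPow_nonneg_of_nonneg hf0 n) hf0 x

/-- `f^{⋆n}` is summable with `Σ f^{⋆n} = (Σ f)^n`, for summable `f ≥ 0`. [cite: FitznerVanDerHofstad2016NoBLE, (1.3)] -/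
theorem hasSum_convPow (hf : Summable f) (hf0 : ∀ x, 0 ≤ f x) :
    ∀ n : ℕ, HasSum (convPow f n) ((∑' y, f y) ^ n)
  | 0 => by rw [pow_zero]; exact hasSum_delta0
  | n + 1 => by
    have ih := hasSum_convPow hf hf0 n
    have hs : Summable (convPow f (n + 1)) :=
      summable_latticeConv ih.summable hf (convPow_nonneg_of_nonneg hf0 n) hf0
    have hv : ∑' x, convPow f (n + 1) x = (∑' y, f y) ^ (n + 1) := by
      change ∑' x, latticeConv (convPow f n) f x = _
      rw [tsum_latticeConv ih.summable hf (convPow_nonneg_of_nonneg hf0 n) hf0, ih.tsum_eq, pow_succ]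
    rw [← hv]
    exact hs.hasSum

/-- `f^{⋆n}` is summable for summable `f ≥ 0`. [folklore] -/
theorem summable_convPow_of_summable (hf : Summable f) (hf0 : ∀ x, 0 ≤ f x) (n : ℕ) :
    Summable (convPow f n) :=
  (hasSum_convPow hf hf0 n).summable

/-- `Σ f^{⋆n} = (Σ f)^n`. [cite: FitznerVanDerHofstad2016NoBLE, (1.3)] -/
theorem tsum_convPow (hf : Summable f) (hf0 : ∀ x, 0 ≤ f x) (n : ℕ) :
    ∑' x, convPow f n x = (∑' y, f y) ^ n :=
  (hasSum_convPow hf hf0 n).tsum_eq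

/-- Monotonicity of convolution powers: `0 ≤ f ≤ f'`, `f'` summable ⟹ `f^{⋆n} ≤ f'^{⋆n}`. [folklore] -/
theorem convPow_mono (hf' : Summable f') (hf0 : ∀ x, 0 ≤ f x) (hff : ∀ x, f x ≤ f' x) :
    ∀ (n : ℕ) (x : Site d), convPow f n x ≤ convPow f' n x
  | 0, x => le_rfl
  | n + 1, x => by
    have hf0' : ∀ x, 0 ≤ f' x := fun x => (hf0 x).trans (hff x)
    exact latticeConv_mono (summable_convPow_of_summable hf' hf0' n) hf' (convPow_nonneg_of_nonneg hf0 n) hf0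
      (convPow_mono hf' hf0 hff n) hff x

/-- A probability step distribution has convolution powers bounded by `1`:
`0 ≤ f`, `Σ f ≤ 1` ⟹ `f^{⋆n} ≤ 1`. [folklore] -/
theorem convPow_le_one_of_tsum_le_one (hf : Summable f) (hf0 : ∀ x, 0 ≤ f x) (hf1 : ∑' y, f y ≤ 1) :
    ∀ (n : ℕ) (x : Site d), convPow f n x ≤ 1
  | 0, x => delta0_le_one x
  | n + 1, x => by
    change latticeConv (convPow f n) f x ≤ 1
    have h1 : ∀ y, f y ≤ 1 := fun y =>
      (le_hasSum hf.hasSum y fun z _ => hf0 z).trans hf1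
    calc latticeConv (convPow f n) f x ≤ (∑' y, convPow f n y) * 1 :=
          latticeConv_le_tsum_mul (summable_convPow_of_summable hf hf0 n) (convPow_nonneg_of_nonneg hf0 n) hf0 h1 x
      _ = (∑' y, f y) ^ n := by rw [mul_one, tsum_convPow hf hf0 n]
      _ ≤ 1 := pow_le_one₀ (tsum_nonneg hf0) hf1

end ConvPow

/-! ### The step distribution `D` -/

/-- `D ≥ 0`. [folklore] -/
theorem srwStep_nonneg (x : Site d) : 0 ≤ srwStep d x := by
  unfold srwStep; split_ifs <;> positivity

/-- `D` vanishes off the neighbours of the origin. [folklore] -/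
theorem srwStep_of_not_adj {x : Site d} (hx : ¬(zdGraph d).Adj 0 x) : srwStep d x = 0 := by
  unfold srwStep; rw [if_neg hx]

/-- `D` is summable (finite support). [folklore] -/
theorem summable_srwStep : Summable (srwStep d) := by
  classical
  refine summable_of_ne_finset_zero (s := (zdGraph d).neighborFinset 0) fun x hx => ?_
  exact srwStep_of_not_adj (fun h => hx ((SimpleGraph.mem_neighborFinset _ _ _).2 h))

/-- `Σ_x D(x) ≤ 1` (it equals `1` for `d ≥ 1`; for `d = 0` the origin has no neighbours).
[cite: FitznerVanDerHofstad2016NoBLE, (1.1)] -/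
theorem tsum_srwStep_le_one : ∑' x, srwStep d x ≤ 1 := by
  classical
  have hsupp : ∀ x ∉ (zdGraph d).neighborFinset 0, srwStep d x = 0 := fun x hx =>
    srwStep_of_not_adj (fun h => hx ((SimpleGraph.mem_neighborFinset _ _ _).2 h))
  rw [tsum_eq_sum hsupp]
  have hval : ∀ x ∈ (zdGraph d).neighborFinset 0, srwStep d x = 1 / (2 * d) := fun x hx => by
    unfold srwStep; rw [if_pos ((SimpleGraph.mem_neighborFinset _ _ _).1 hx)]
  rw [Finset.sum_congr rfl hval, Finset.sum_const, SimpleGraph.card_neighborFinset_eq_degree,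
    nsmul_eq_mul]
  -- `deg(0) ≤ 2d`
  have hdeg : (zdGraph d).degree 0 ≤ 2 * d := by
    rw [← SimpleGraph.card_neighborFinset_eq_degree]
    set φ : Fin d × Bool → Site d := fun ib => if ib.2 then Pi.single ib.1 1 else -Pi.single ib.1 1
    have hsub : (zdGraph d).neighborFinset 0 ⊆ (Finset.univ : Finset (Fin d × Bool)).image φ := by
      intro x hx
      have h := (SimpleGraph.mem_neighborFinset _ _ _).1 hx
      obtain ⟨i, h | h⟩ := (zdGraph_adj_iff 0 x).1 h
      · exact Finset.mem_image.2 ⟨(i, true), Finset.mem_univ _, by rw [h, zero_add]; simp [φ]⟩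
      · refine Finset.mem_image.2 ⟨(i, false), Finset.mem_univ _, ?_⟩
        have hx' : x = -Pi.single i 1 := eq_neg_of_add_eq_zero_left h.symm
        rw [hx']; simp [φ]
    calc ((zdGraph d).neighborFinset 0).card ≤ ((Finset.univ : Finset (Fin d × Bool)).image φ).card :=
          Finset.card_le_card hsub
      _ ≤ (Finset.univ : Finset (Fin d × Bool)).card := Finset.card_image_le
      _ = 2 * d := by simp [Fintype.card_prod, Fintype.card_bool, mul_comm]
  rcases Nat.eq_zero_or_pos d with hd | hd
  · subst hd
    have : (zdGraph 0).degree 0 = 0 := by omega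
    rw [this]; norm_num
  · have hdeg' : ((zdGraph d).degree 0 : ℝ) ≤ 2 * d := by exact_mod_cast hdeg
    have hd' : (0 : ℝ) < 2 * d := by positivity
    rw [mul_one_div, div_le_one hd']
    exact hdeg'


/-- `D^{⋆l}` is non-negative, summable and bounded by `1`. [folklore] -/
theorem convPow_srwStep_le_one (l : ℕ) (x : Site d) : convPow (srwStep d) l x ≤ 1 :=
  convPow_le_one_of_tsum_le_one summable_srwStep srwStep_nonneg tsum_srwStep_le_one l x

/-! ### Decay at infinity of a convolution `a ⋆ K` with `a ∈ ℓ¹`, `K` bounded and `K → 0` -/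

/-- If `a ≥ 0` is summable and `0 ≤ K ≤ M` tends to `0` at infinity, then `(a ⋆ K)(x) → 0` as
`x → ∞` (along the cofinite filter of `ℤ^d`): split `a` into a finite part, on which finitely many
translates of `K` tend to `0`, and a tail of mass `< δ`, which contributes at most `Mδ`. [folklore] -/
theorem tendsto_latticeConv_cofinite {a K : Site d → ℝ} (ha : Summable a) (ha0 : ∀ x, 0 ≤ a x)
    (hK0 : ∀ x, 0 ≤ K x) {M : ℝ} (hKM : ∀ x, K x ≤ M) (hK : Tendsto K cofinite (𝓝 0)) :
    Tendsto (latticeConv a K) cofinite (𝓝 0) := by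
  have hM0 : 0 ≤ M := (hK0 0).trans (hKM 0)
  rw [Metric.tendsto_nhds]
  intro ε hε
  set δ : ℝ := ε / (2 * (M + 1)) with hδ
  have hδpos : 0 < δ := by positivity
  -- a finite set carrying all but `δ` of the mass of `a`
  obtain ⟨F, hF⟩ : ∃ F : Finset (Site d), ∑' y : {y // y ∉ F}, a y < δ :=
    ((tendsto_tsum_compl_atTop_zero a).eventually (gt_mem_nhds hδpos)).exists
  -- the finite part tends to `0`
  have hfin : Tendsto (fun x => ∑ y ∈ F, a y * K (x - y)) cofinite (𝓝 0) := by
    have hy : ∀ y ∈ F, Tendsto (fun x => a y * K (x - y)) cofinite (𝓝 0) := fun y _ => by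
      have ht : Tendsto (fun x : Site d => x - y) cofinite cofinite :=
        sub_left_injective.tendsto_cofinite
      simpa using (hK.comp ht).const_mul (a y)
    simpa using tendsto_finsetSum F hy
  filter_upwards [(Metric.tendsto_nhds.1 hfin) δ hδpos] with x hx
  -- summability of the family at `x` and the split into `F` and its complement
  have hs : Summable fun y => a y * K (x - y) :=
    Summable.of_nonneg_of_le (fun y => mul_nonneg (ha0 y) (hK0 _))
      (fun y => mul_le_mul_of_nonneg_left (hKM _) (ha0 y)) (ha.mul_right M)
  have hsplit := hs.sum_add_tsum_compl (s := F)
  have htail : ∑' y : (↑(↑F : Set (Site d))ᶜ : Set (Site d)), a y * K (x - y) ≤ M * δ := by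
    have h1 : ∑' y : (↑(↑F : Set (Site d))ᶜ : Set (Site d)), a y * K (x - y) ≤
        ∑' y : (↑(↑F : Set (Site d))ᶜ : Set (Site d)), a y * M :=
      (hs.subtype _).tsum_le_tsum (fun y => mul_le_mul_of_nonneg_left (hKM _) (ha0 _))
        ((ha.mul_right M).subtype _)
    have h2 : ∑' y : (↑(↑F : Set (Site d))ᶜ : Set (Site d)), a y * M =
        (∑' y : {y // y ∉ F}, a y) * M := by
      rw [← tsum_mul_right]; rfl
    rw [h2] at h1
    calc _ ≤ (∑' y : {y // y ∉ F}, a y) * M := h1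
      _ ≤ δ * M := mul_le_mul_of_nonneg_right hF.le hM0
      _ = M * δ := mul_comm _ _
  have hconv : latticeConv a K x = ∑ y ∈ F, a y * K (x - y) +
      ∑' y : (↑(↑F : Set (Site d))ᶜ : Set (Site d)), a y * K (x - y) := by
    rw [latticeConv, hsplit]
  rw [Real.dist_0_eq_abs, abs_of_nonneg (latticeConv_nonneg ha0 hK0 x), hconv]
  rw [Real.dist_0_eq_abs] at hx
  have hfinle : ∑ y ∈ F, a y * K (x - y) < δ := (le_abs_self _).trans_lt hx
  have hMδ : M * δ + δ ≤ ε / 2 := by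
    rw [hδ]
    have : M * (ε / (2 * (M + 1))) + ε / (2 * (M + 1)) = ε / 2 := by field_simp
    rw [this]
  linarith

/-! ### A `sup` of an equicontinuous, dominated family is continuous -/

/-- **Continuity of a supremum under domination by a null sequence.** Let `h p x ≥ 0` be
continuous in `p` (within `s`, at `p₀ ∈ s`) for each index `x`, and dominated on `s` by `B x` with
`B x → 0` as `x → ∞`. Then `p ↦ sup_x h p x` is continuous within `s` at `p₀`: for `ε > 0` only the
finitely many `x` with `B x ≥ ε` matter, up to an error `ε`. (This is the mechanism of the proof of
[FitHof13b] Lemma 3.5, "equicontinuous family … Arzelà–Ascoli".)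
[cite: FitznerVanDerHofstad2016NoBLE, Lemma 3.5 (proof)] -/
theorem continuousWithinAt_iSup_of_dominated {α ι : Type*} [TopologicalSpace α]
    {h : α → ι → ℝ} {B : ι → ℝ} {s : Set α} {p₀ : α} (hp₀ : p₀ ∈ s)
    (hcont : ∀ x, ContinuousWithinAt (fun p => h p x) s p₀)
    (h0 : ∀ p ∈ s, ∀ x, 0 ≤ h p x) (hdom : ∀ p ∈ s, ∀ x, h p x ≤ B x)
    (hB : Tendsto B cofinite (𝓝 0)) :
    ContinuousWithinAt (fun p => ⨆ x, h p x) s p₀ := by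
  classical
  rcases isEmpty_or_nonempty ι with hι | hι
  · simp only [Real.iSup_of_isEmpty]
    exact continuousWithinAt_const
  obtain ⟨x₀⟩ := hι
  haveI : Nonempty ι := ⟨x₀⟩
  have hbdd : ∀ p ∈ s, BddAbove (Set.range (h p)) := by
    intro p hp
    obtain ⟨C, hC⟩ := hB.bddAbove_range_of_cofinite
    exact ⟨C, by rintro _ ⟨x, rfl⟩; exact (hdom p hp x).trans (hC ⟨x, rfl⟩)⟩
  rw [Metric.continuousWithinAt_iff']
  intro ε hε
  -- the finitely many indices where the dominating function is `≥ ε/3`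
  have hfinite : {x | ¬ B x < ε / 3}.Finite :=
    Filter.eventually_cofinite.1 ((tendsto_order.1 hB).2 (ε / 3) (by positivity))
  set F : Finset ι := hfinite.toFinset ∪ {x₀} with hF
  have hFne : F.Nonempty := ⟨x₀, by simp [hF]⟩
  set m : α → ℝ := fun p => F.sup' hFne fun x => h p x with hm
  -- `m p ≤ sup ≤ m p + ε/3` on `s`
  have hlow : ∀ p ∈ s, m p ≤ ⨆ x, h p x := fun p hp =>
    Finset.sup'_le _ _ fun x _ => le_ciSup (hbdd p hp) x
  have hupp : ∀ p ∈ s, (⨆ x, h p x) ≤ m p + ε / 3 := by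
    intro p hp
    refine ciSup_le fun x => ?_
    by_cases hx : x ∈ F
    · have h1 : h p x ≤ m p := Finset.le_sup' (fun x => h p x) hx
      linarith
    · have hBx : B x < ε / 3 := by
        by_contra hcon
        exact hx (Finset.mem_union_left _ (hfinite.mem_toFinset.2 hcon))
      have h2 : 0 ≤ m p := (h0 p hp x₀).trans (Finset.le_sup' (fun x => h p x) (by simp [hF]))
      linarith [hdom p hp x]
  -- `m` is continuous within `s` at `p₀`
  have hmcont : ContinuousWithinAt m s p₀ :=
    ContinuousWithinAt.finset_sup'_apply hFne fun x _ => hcont x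
  have hev := (Metric.continuousWithinAt_iff'.1 hmcont) (ε / 3) (by positivity)
  filter_upwards [hev, self_mem_nhdsWithin] with p hp hps
  rw [Real.dist_eq] at hp ⊢
  have a1 := hlow p hps
  have a2 := hupp p hps
  have b1 := hlow p₀ hp₀
  have b2 := hupp p₀ hp₀
  rw [abs_sub_lt_iff] at hp ⊢
  constructor <;> linarith [hp.1, hp.2]

/-! ### The weighted diagrams below `p_c`: bounds, monotonicity, continuity, decay -/

section Diagrams

variable (hd : 2 ≤ d)
include hd

/-- Summability of `τ_p(0,·)` for `p ≤ q < p_c`. [folklore] -/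
theorem summable_tau_of_le {p q : unitInterval} (hpq : p ≤ q)
    (hq : (q : ℝ) < criticalProb (zdGraph d) (0 : Site d)) : Summable fun x => tau d p 0 x :=
  Summable.of_nonneg_of_le (fun x => tau_nonneg p 0 x) (fun x => tau_mono_left hpq 0 x)
    (summable_tau_of_lt_criticalProb hd q hq)

/-- Summability of `‖x‖₂² τ_p(0,x)` for `p ≤ q < p_c`. [folklore] -/
theorem summable_weight_of_le {p q : unitInterval} (hpq : p ≤ q)
    (hq : (q : ℝ) < criticalProb (zdGraph d) (0 : Site d)) :
    Summable fun x => euclidNorm x ^ 2 * tau d p 0 x :=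
  Summable.of_nonneg_of_le (fun x => mul_nonneg (sq_nonneg _) (tau_nonneg p 0 x))
    (fun x => mul_le_mul_of_nonneg_left (tau_mono_left hpq 0 x) (sq_nonneg _))
    (summable_euclidNorm_sq_mul_tau hd q hq)

omit hd in
/-- The kernel `K_p = τ_p^{⋆n} ⋆ D^{⋆l}` is non-negative. [folklore] -/
theorem nobleKernel_nonneg (n l : ℕ) (p : unitInterval) (z : Site d) :
    0 ≤ latticeConv (convPow (tau d p 0) n) (convPow (srwStep d) l) z :=
  latticeConv_nonneg (convPow_nonneg_of_nonneg (fun x => tau_nonneg p 0 x) n)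
    (convPow_nonneg_of_nonneg srwStep_nonneg l) z

/-- The kernel is bounded by `χ(p)^n` (as `D^{⋆l} ≤ 1`). [cite: FitznerVanDerHofstad2016NoBLE, Lemma 3.5 (proof: sup_y (G_z^{⋆n} ⋆ D^{⋆l})(y) ≤ χ^n)] -/
theorem nobleKernel_le (n l : ℕ) {p q : unitInterval} (hpq : p ≤ q) (hq : (q : ℝ) < criticalProb (zdGraph d) (0 : Site d))
    (z : Site d) :
    latticeConv (convPow (tau d p 0) n) (convPow (srwStep d) l) z ≤ (∑' y, tau d p 0 y) ^ n := by
  have hs := summable_tau_of_le hd hpq hq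
  have h0 : ∀ x, 0 ≤ tau d p 0 x := fun x => tau_nonneg p 0 x
  calc _ ≤ (∑' w, convPow (tau d p 0) n w) * 1 :=
        latticeConv_le_tsum_mul (summable_convPow_of_summable hs h0 n) (convPow_nonneg_of_nonneg h0 n)
          (convPow_nonneg_of_nonneg srwStep_nonneg l) (convPow_srwStep_le_one l) z
    _ = (∑' y, tau d p 0 y) ^ n := by rw [mul_one, tsum_convPow hs h0 n]

/-- The kernel is summable for `p ≤ q < p_c`. [folklore] -/
theorem summable_nobleKernel (n l : ℕ) {p q : unitInterval} (hpq : p ≤ q) (hq : (q : ℝ) < criticalProb (zdGraph d) (0 : Site d)) :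
    Summable (latticeConv (convPow (tau d p 0) n) (convPow (srwStep d) l)) :=
  summable_latticeConv (summable_convPow_of_summable (summable_tau_of_le hd hpq hq) (fun x => tau_nonneg p 0 x) n)
    (summable_convPow_of_summable summable_srwStep srwStep_nonneg l)
    (convPow_nonneg_of_nonneg (fun x => tau_nonneg p 0 x) n) (convPow_nonneg_of_nonneg srwStep_nonneg l)

/-- The kernel is non-decreasing in `p` (below `p_c`). [folklore] -/
theorem nobleKernel_mono (n l : ℕ) {p q : unitInterval} (hpq : p ≤ q) (hq : (q : ℝ) < criticalProb (zdGraph d) (0 : Site d))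
    (z : Site d) :
    latticeConv (convPow (tau d p 0) n) (convPow (srwStep d) l) z ≤
      latticeConv (convPow (tau d q 0) n) (convPow (srwStep d) l) z := by
  have hsq := summable_tau_of_le hd le_rfl hq
  exact latticeConv_mono (summable_convPow_of_summable hsq (fun x => tau_nonneg q 0 x) n)
    (summable_convPow_of_summable summable_srwStep srwStep_nonneg l)
    (convPow_nonneg_of_nonneg (fun x => tau_nonneg p 0 x) n) (convPow_nonneg_of_nonneg srwStep_nonneg l)
    (convPow_mono hsq (fun x => tau_nonneg p 0 x) (fun x => tau_mono_left hpq 0 x) n)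
    (fun _ => le_rfl) z

omit hd in
/-- `ℋ^{n,l}_p = (‖·‖₂² τ_p) ⋆ K_p` is itself a convolution. [cite: FitznerVanDerHofstad2016NoBLE, (3.9)] -/
theorem nobleH_eq_latticeConv (n l : ℕ) (p : unitInterval) (x : Site d) :
    nobleH d n l p x = latticeConv (fun y => euclidNorm y ^ 2 * tau d p 0 y)
      (latticeConv (convPow (tau d p 0) n) (convPow (srwStep d) l)) x := rfl

omit hd in
/-- `ℋ^{n,l}_p(x) ≥ 0`. [folklore] -/
theorem nobleH_nonneg (n l : ℕ) (p : unitInterval) (x : Site d) : 0 ≤ nobleH d n l p x :=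
  latticeConv_nonneg (fun y => mul_nonneg (sq_nonneg _) (tau_nonneg p 0 y)) (nobleKernel_nonneg n l p) x

/-- `ℋ^{n,l}_p(x)` is non-decreasing in `p` below `p_c`. [folklore] -/
theorem nobleH_mono (n l : ℕ) {p q : unitInterval} (hpq : p ≤ q) (hq : (q : ℝ) < criticalProb (zdGraph d) (0 : Site d))
    (x : Site d) : nobleH d n l p x ≤ nobleH d n l q x :=
  latticeConv_mono (summable_weight_of_le hd le_rfl hq) (summable_nobleKernel hd n l le_rfl hq)
    (fun y => mul_nonneg (sq_nonneg _) (tau_nonneg p 0 y)) (nobleKernel_nonneg n l p)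
    (fun y => mul_le_mul_of_nonneg_left (tau_mono_left hpq 0 y) (sq_nonneg _))
    (nobleKernel_mono hd n l hpq hq) x

/-- **`ℋ^{n,l}_q(x) → 0` as `x → ∞`** for `q < p_c`. [folklore] -/
theorem tendsto_nobleH_cofinite (n l : ℕ) {q : unitInterval}
    (hq : (q : ℝ) < criticalProb (zdGraph d) (0 : Site d)) :
    Tendsto (nobleH d n l q) cofinite (𝓝 0) :=
  tendsto_latticeConv_cofinite (summable_weight_of_le hd le_rfl hq)
    (fun y => mul_nonneg (sq_nonneg _) (tau_nonneg q 0 y)) (nobleKernel_nonneg n l q)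
    (nobleKernel_le hd n l le_rfl hq) (summable_nobleKernel hd n l le_rfl hq).tendsto_cofinite_zero

/-- Continuity of `p ↦ τ_p^{⋆n}(z)` on `[0, q]`, `q < p_c` (dominated convergence, by induction on
`n`). [cite: FitznerVanDerHofstad2016NoBLE, Lemma 3.5 (proof)] -/
theorem continuousOn_convPow_tau {q : unitInterval}
    (hq : (q : ℝ) < criticalProb (zdGraph d) (0 : Site d)) :
    ∀ (n : ℕ) (z : Site d),
      ContinuousOn (fun p : unitInterval => convPow (tau d p 0) n z) (Set.Iic q)
  | 0, z => continuousOn_const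
  | n + 1, z => by
    have hsq := summable_tau_of_le hd le_rfl hq
    have hTq : Summable (convPow (tau d q 0) n) :=
      summable_convPow_of_summable hsq (fun x => tau_nonneg q 0 x) n
    change ContinuousOn (fun p : unitInterval => ∑' w, convPow (tau d p 0) n w * tau d p 0 (z - w))
      (Set.Iic q)
    refine continuousOn_tsum (fun w => ?_) hTq fun w p hp => ?_
    · exact (continuousOn_convPow_tau hq n w).mul (continuous_tau 0 (z - w)).continuousOn
    · rw [Real.norm_eq_abs, abs_of_nonneg (mul_nonneg (convPow_nonneg_of_nonneg (fun x => tau_nonneg p 0 x) n w)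
        (tau_nonneg p 0 _))]
      calc convPow (tau d p 0) n w * tau d p 0 (z - w) ≤ convPow (tau d q 0) n w * 1 :=
            mul_le_mul (convPow_mono hsq (fun x => tau_nonneg p 0 x) (fun x => tau_mono_left hp 0 x) n w)
              (tau_le_one p 0 _) (tau_nonneg p 0 _) (convPow_nonneg_of_nonneg (fun x => tau_nonneg q 0 x) n w)
        _ = convPow (tau d q 0) n w := mul_one _

/-- Continuity of `p ↦ K_p(z) = (τ_p^{⋆n} ⋆ D^{⋆l})(z)` on `[0, q]`, `q < p_c`. [cite: FitznerVanDerHofstad2016NoBLE, Lemma 3.5 (proof)] -/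
theorem continuousOn_nobleKernel (n l : ℕ) {q : unitInterval}
    (hq : (q : ℝ) < criticalProb (zdGraph d) (0 : Site d)) (z : Site d) :
    ContinuousOn (fun p : unitInterval =>
      latticeConv (convPow (tau d p 0) n) (convPow (srwStep d) l) z) (Set.Iic q) := by
  have hsq := summable_tau_of_le hd le_rfl hq
  have hTq : Summable (convPow (tau d q 0) n) := summable_convPow_of_summable hsq (fun x => tau_nonneg q 0 x) n
  change ContinuousOn (fun p : unitInterval =>
    ∑' w, convPow (tau d p 0) n w * convPow (srwStep d) l (z - w)) (Set.Iic q)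
  refine continuousOn_tsum (fun w => ?_) hTq fun w p hp => ?_
  · exact (continuousOn_convPow_tau hd hq n w).mul continuousOn_const
  · rw [Real.norm_eq_abs, abs_of_nonneg (mul_nonneg (convPow_nonneg_of_nonneg (fun x => tau_nonneg p 0 x) n w)
      (convPow_nonneg_of_nonneg srwStep_nonneg l _))]
    calc convPow (tau d p 0) n w * convPow (srwStep d) l (z - w) ≤ convPow (tau d q 0) n w * 1 :=
          mul_le_mul (convPow_mono hsq (fun x => tau_nonneg p 0 x) (fun x => tau_mono_left hp 0 x) n w)
            (convPow_srwStep_le_one l _) (convPow_nonneg_of_nonneg srwStep_nonneg l _)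
            (convPow_nonneg_of_nonneg (fun x => tau_nonneg q 0 x) n w)
      _ = convPow (tau d q 0) n w := mul_one _

/-- **Continuity of `p ↦ ℋ^{n,l}_p(x)` on `[0, q]`, `q < p_c`** (dominated convergence with the
dominating family `‖y‖₂² τ_q(y) χ(q)^n`). [cite: FitznerVanDerHofstad2016NoBLE, Lemma 3.5 (proof)] -/
theorem continuousOn_nobleH (n l : ℕ) {q : unitInterval}
    (hq : (q : ℝ) < criticalProb (zdGraph d) (0 : Site d)) (x : Site d) :
    ContinuousOn (fun p : unitInterval => nobleH d n l p x) (Set.Iic q) := by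
  have hwq := summable_weight_of_le hd le_rfl hq
  change ContinuousOn (fun p : unitInterval => ∑' y, euclidNorm y ^ 2 * tau d p 0 y *
    latticeConv (convPow (tau d p 0) n) (convPow (srwStep d) l) (x - y)) (Set.Iic q)
  refine continuousOn_tsum (fun y => ?_) (hwq.mul_right ((∑' y, tau d q 0 y) ^ n)) fun y p hp => ?_
  · exact ((continuousOn_const.mul (continuous_tau 0 y).continuousOn)).mul
      (continuousOn_nobleKernel hd n l hq (x - y))
  · rw [Real.norm_eq_abs, abs_of_nonneg (mul_nonneg (mul_nonneg (sq_nonneg _) (tau_nonneg p 0 y))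
      (nobleKernel_nonneg n l p _))]
    refine mul_le_mul (mul_le_mul_of_nonneg_left (tau_mono_left hp 0 y) (sq_nonneg _)) ?_
      (nobleKernel_nonneg n l p _) (mul_nonneg (sq_nonneg _) (tau_nonneg q 0 y))
    exact (nobleKernel_mono hd n l hp hq _).trans (nobleKernel_le hd n l le_rfl hq _)

/-- **[FitHof13b] Lemma 3.5 for percolation, on `[0, p_c)`**: for `d ≥ 2`, all `n, l` and
`S ⊆ ℤ^d`, `p ↦ sup_{x ∈ S} ℋ^{n,l}_p(x)` is continuous on `[0, p_c)`.
[cite: FitznerVanDerHofstad2016NoBLE, Lemma 3.5] -/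
theorem continuousOn_nobleSupH (n l : ℕ) (S : Set (Site d)) :
    ContinuousOn (nobleSupH d n l S) (Set.Iio (criticalProbI d)) := by
  intro p₀ hp₀
  obtain ⟨q, hpq, hqc⟩ := exists_lt_lt_criticalProbI hp₀
  have hIic : Set.Iic q ∈ 𝓝 p₀ := Iic_mem_nhds hpq
  have hwithin : ContinuousWithinAt (nobleSupH d n l S) (Set.Iic q) p₀ := by
    change ContinuousWithinAt (fun p => ⨆ x : S, nobleH d n l p x.1) (Set.Iic q) p₀
    refine continuousWithinAt_iSup_of_dominated (B := fun x : S => nobleH d n l q x.1)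
      (Set.mem_Iic.2 hpq.le) (fun x => (continuousOn_nobleH hd n l hqc x.1) p₀ (Set.mem_Iic.2 hpq.le))
      (fun p _ x => nobleH_nonneg n l p x.1) (fun p hp x => nobleH_mono hd n l hp hqc x.1) ?_
    exact (tendsto_nobleH_cofinite hd n l hqc).comp Subtype.val_injective.tendsto_cofinite
  exact ((continuousWithinAt_iff_continuousAt hIic).1 hwithin).continuousWithinAt

end Diagrams

/-- **`FitznerVanDerHofstad2016NoBLE_lemma35` discharged**: [FitHof13b] Lemma 3.5 for percolation
(`d ≥ 2`, all `n, l, S`), by restricting `continuousOn_nobleSupH` from `[0, p_c)` to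
`[1/(2d-1), p_c)`. [cite: FitznerVanDerHofstad2016NoBLE, Lemma 3.5] -/
theorem FitznerVanDerHofstad2016NoBLE_lemma35_holds : FitznerVanDerHofstad2016NoBLE_lemma35 :=
  fun _ hd n l S => (continuousOn_nobleSupH hd n l S).mono fun _ hp => hp.2

/-- **Claim (i) in full**: all three bootstrap functions `f₁, f₂, f₃` of the NoBLE analysis of
percolation are continuous on `[1/(2d-1), p_c)` (`d ≥ 2`), unconditionally.
[cite: FitznerVanDerHofstad2017, §2.4 (claim (i))] [cite: FitznerVanDerHofstad2016NoBLE, Prop. 2.11 (continuity) with Lemma 3.3 and Lemma 3.5] -/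
theorem continuousOn_nobleF' (hd : 2 ≤ d) (cμ : ℝ) (c : Fin 6 → ℝ) (i : Fin 3) :
    ContinuousOn (nobleF d cμ c i) (Set.Ico (nbwThresholdI d) (criticalProbI d)) :=
  continuousOn_nobleF FitznerVanDerHofstad2016NoBLE_lemma35_holds hd cμ c i

/-- **`FitznerVanDerHofstad2017_nobleBound` reduced to its computer-assisted core**: the NoBLE
bound for percolation in `d ≥ 11` ([FitHof13b] Thm. 2.10, first bound) follows from
Fitzner–van der Hofstad 2017, Prop. 2.4 with its initialisation (`FitznerVanDerHofstad2017_prop24`)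
ALONE — claims (i) (continuity of `f₁, f₂, f₃`), Lemma 2.1 (bootstrap) and the passage
Prop. 2.11 ⟹ Thm. 2.10 being formal. [cite: FitznerVanDerHofstad2017, Prop. 2.4 and §2.4]
[cite: FitznerVanDerHofstad2016NoBLE, Thm. 2.10 with Prop. 2.11 and Lemma 2.1] -/
theorem FitznerVanDerHofstad2017_nobleBound_of_prop24' (h24 : FitznerVanDerHofstad2017_prop24) :
    FitznerVanDerHofstad2017_nobleBound :=
  FitznerVanDerHofstad2017_nobleBound_of_prop24 FitznerVanDerHofstad2016NoBLE_lemma35_holds h24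

/-- … and so does the infrared bound `FitznerVanDerHofstad2017_infraredBound` (HvdH Thm. 10.1,
`d ≥ 11`). [cite: HeydenreichVanDerHofstad2017, Thm. 10.1] [cite: FitznerVanDerHofstad2017, Thm. 1.1 and Prop. 2.4] -/
theorem FitznerVanDerHofstad2017_infraredBound_of_prop24' (h24 : FitznerVanDerHofstad2017_prop24) :
    FitznerVanDerHofstad2017_infraredBound :=
  FitznerVanDerHofstad2017_infraredBound_of_nobleBound (FitznerVanDerHofstad2017_nobleBound_of_prop24' h24)

end Literature.Barriers.CriticalPhenomena

end
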